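import Summits.AtomisticToContinuum.BoseEinsteinCondensation.Theorems.BECSwapNoCatastropheTorusHalfSwapOverlapAbsHardLayerPBasics
import Summits.AtomisticToContinuum.BoseEinsteinCondensation.Theorems.BECSwapNoCatastropheTorusHalfSwapOverlapAbsMaxFormBoundL1
import Literature.MathematicalPhysics.QuantumManyBody.PeriodicMaxFormBoundHardCoreStep
import Literature.MathematicalPhysics.QuantumManyBody.PeriodicFormCoreTrigPoly
import HarnessLib

/-!
# Crux `TorusHalfSwapOverlap`, line `registered` (v8, H chain): stub S `stub_pairStep`

Route `BECSwapNoCatastrophe` (sub-problem `BoseEinsteinCondensation`), crux `TorusHalfSwapOverlap`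
(stmt-AtomisticToContinuum-14393), line `registered` (skeleton v8: truncation split; the hard-core maximal-form
bound H on the ABSOLUTE (symmetry-free) class for PAIR-DEPENDENT profiles `V i j`, decomposed into pair-profile
twins of the tree's one-copy hard-core chain). This file is the pair-profile twin of
`Literature/MathematicalPhysics/QuantumManyBody/PeriodicMaxFormBoundHardCoreStep.lean`
(`periodicGroundStateEnergy_mul_le_maxForm_step`): the cut-off step (one `ε`) of the variational principle
`E₀ᴬ(W_V) ‖ζ‖² ≤ maxFormW W_V L ζ` for a pair-profile interaction `W_V = pairInteraction V L` whose profiles are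
repulsive of finite range (hard cores allowed pair by pair), for every BOUNDED `ζ ∈ L²((ℝ/ℤ)^{3N})` whose mass in
the pair-profile hard layers decays, `∫_{fromUnitTorusN L ⁻¹' hardLayerP V L s} |ζ|² = o(s²)`.

Dictionary with the one-copy file: `hardLayer v L s ↦ hardLayerP V L s`, `periodicInteraction v L ↦ pairInteraction V L`,
`awayProfile v θ ↦ softProfile (V i j) θ` per pair, Bose symmetry of states deleted; the transport dictionary
`Ψ ↦ η_Ψ = L^{3N/2} (Ψ ∘ fromUnitTorusN L)` for plain `C¹` periodic `Ψ` (stub D) and the pair-profile cut-off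
(stub K) enter as the written-out hypotheses `hD`, `hK`.

Proof: soften every profile off the `s/2`-neighbourhood of ITS hard radii (`softProfile`, integrable on the cell),
approximate `ζ` in the softened maximal form by a trigonometric polynomial `P` (`exists_trigPoly_maxFormW_approx`),
realise `P` as the plain `C¹` periodic function `Ψ = L^{-3N/2} ∑ aₙ e^{2πi n·X/L}`, multiply by the cut-off `ξ_s` of
`hK` and apply the absolute variational principle to `ξ_s Ψ`, whose `W_V`-energy is the softened energy of `Ψ` up to
`O(s⁻²) × (mass of P in the hard layer of width s) = o(1)`.

Tagged as the template (the `L¹_loc` case is B. Simon, J. Operator Theory 1 (1979) Thm. 2.1 /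
[ReedSimonIV1978] Thm. XIII.64).
-/

noncomputable section

namespace Summit.AtomisticToContinuum.BoseEinsteinCondensation.Cruxes.TorusHalfSwapOverlap.TruncationSplit

open MeasureTheory Filter Topology Set Metric UnitAddTorus
open scoped ENNReal NNReal InnerProductSpace ComplexConjugate
open Literature.MathematicalPhysics.QuantumManyBody.BoseGas
open Literature.MathematicalPhysics.QuantumManyBody.BoseGas.HardLayerAux
open Literature.Analysis.FunctionSpaces
open Summit.AtomisticToContinuum.BoseEinsteinCondensation.AbsTorus

-- The measure on `ℝ/ℤ` is the Haar PROBABILITY measure, as in `PeriodicFormDomain.lean`.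
attribute [local instance] formDomain_measureSpace formDomain_isProbabilityMeasure formDomain_isProbabilityMeasure_pi

/-- Local notation for the Hilbert space `H = L²((ℝ/ℤ)^{3N})`. -/
local notation "L2T " N':max => Lp ℂ 2 (volume : Measure (UnitAddTorus (Fin N' × Fin 3)))

variable {N : ℕ} {L : ℝ}

/-! ### The absolute variational principle for un-normalised functions -/

/-- **The absolute variational principle, un-normalised form.** For a `C¹`, `Lℤ³`-periodic `Φ : Config N → ℂ`
and every weight `W`, `E₀ᴬ(W) · ∫_{[0,L)^{3N}} |Φ|² ≤ absEnergyW W L Φ` (trivial if `∫|Φ|² = 0`; otherwise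
`Φ / (∫|Φ|²)^{1/2} ∈ AbsAdm N L` and `absEnergyW` is `2`-homogeneous). [folklore] -/
theorem pairStep_absGroundStateEnergyW_mul_le {W : Config N → ℝ≥0∞} {Φ : Config N → ℂ} (hΦ : ContDiff ℝ 1 Φ)
    (hper : IsTorusPeriodic L Φ) :
    absGroundStateEnergyW W L * (∫⁻ X in cellN N L, (‖Φ X‖₊ : ℝ≥0∞) ^ 2) ≤ absEnergyW W L Φ := by
  set m : ℝ≥0∞ := ∫⁻ X in cellN N L, (‖Φ X‖₊ : ℝ≥0∞) ^ 2 with hm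
  have hmtop : m ≠ ⊤ := (lintegral_cellN_sq_lt_top L hΦ.continuous).ne
  rcases eq_or_ne m 0 with hm0 | hm0
  · rw [hm0, mul_zero]; exact zero_le
  have hmpos : 0 < m.toReal := ENNReal.toReal_pos hm0 hmtop
  -- the normalising constant
  set c : ℝ := (Real.sqrt m.toReal)⁻¹ with hc
  have hc0 : 0 ≤ c := inv_nonneg.2 (Real.sqrt_nonneg _)
  have hsq : ∀ z : ℂ, ((‖(c : ℂ) * z‖₊ : ℝ≥0∞)) ^ 2 = ENNReal.ofReal (c ^ 2) * (‖z‖₊ : ℝ≥0∞) ^ 2 := fun z => by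
    rw [coe_nnnorm_sq_eq_ofReal, coe_nnnorm_sq_eq_ofReal, norm_mul, Complex.norm_real, Real.norm_of_nonneg hc0,
      mul_pow, ENNReal.ofReal_mul (sq_nonneg _)]
  have hcc : ENNReal.ofReal (c ^ 2) * m = 1 := by
    rw [← ENNReal.ofReal_toReal hmtop, ← ENNReal.ofReal_mul (sq_nonneg _), hc, inv_pow, Real.sq_sqrt hmpos.le,
      inv_mul_cancel₀ hmpos.ne', ENNReal.ofReal_one]
  have hadm : AbsAdm N L (fun X => (c : ℂ) * Φ X) := by
    refine ⟨contDiff_const.mul hΦ, fun X i k => ?_, ?_⟩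
    · dsimp only
      rw [hper X i k]
    · simp only [hsq]
      rw [lintegral_const_mul' _ _ ENNReal.ofReal_ne_top, hcc]
  have hE : absEnergyW W L (fun X => (c : ℂ) * Φ X) = ENNReal.ofReal (c ^ 2) * absEnergyW W L Φ := by
    rw [absEnergyW_def, absEnergyW_def, ← lintegral_const_mul' _ _ ENNReal.ofReal_ne_top]
    refine lintegral_congr fun X => ?_
    rw [kineticDensity_const_mul hΦ c hc0, hsq]
    ring
  calc absGroundStateEnergyW W L * m ≤ ENNReal.ofReal (c ^ 2) * absEnergyW W L Φ * m :=
        mul_le_mul_left ((absGroundStateEnergyW_le hadm).trans_eq hE) _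
    _ = absEnergyW W L Φ := by rw [mul_comm (ENNReal.ofReal (c ^ 2)), mul_assoc, hcc, mul_one]

/-! ### The registered stub -/

/-- **Stub S (L; dictionary D and cut-off K as hypotheses): the cut-off step for pair profiles** (twin of
`periodicGroundStateEnergy_mul_le_maxForm_step`). Under the transport dictionary `hD` for plain `C¹` periodic
functions and the pair-profile cut-off `hK`: let `L > 0`, `V` a symmetric matrix of repulsive finite-range
profiles, `ζ ∈ L²((ℝ/ℤ)^{3N})` bounded with hard-layer decay
`∫_{fromUnitTorusN L ⁻¹' hardLayerP V L s} |ζ|² ≤ ε' s²` for all small `s` (every `ε' > 0`). Then for every `ε > 0`,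
`E₀ᴬ(W_V) · (‖ζ‖² - ε) ≤ (1 + ε) maxFormW W_V L ζ + ε`. [cite: ReedSimonIV1978, Thm. XIII.64] -/
theorem stub_pairStep :
    (∀ (N : ℕ) (L : ℝ), 0 < L → ∀ Ψ : Config N → ℂ, ContDiff ℝ 1 Ψ → IsTorusPeriodic L Ψ →
      ∃ ηΨ : Lp ℂ 2 (volume : Measure (UnitAddTorus (Fin N × Fin 3))),
        (∀ᵐ t ∂(volume : Measure (UnitAddTorus (Fin N × Fin 3))),
          (ηΨ : UnitAddTorus (Fin N × Fin 3) → ℂ) t = (cellScale N L : ℂ) * Ψ (fromUnitTorusN L t)) ∧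
        ENNReal.ofReal (‖ηΨ‖ ^ 2) = ∫⁻ X in cellN N L, (‖Ψ X‖₊ : ℝ≥0∞) ^ 2 ∧
        maxFormKin L ηΨ = ∫⁻ X in cellN N L, kineticDensity Ψ X ∧
        ∀ W : Config N → ℝ≥0∞, Measurable W →
          maxFormPotW W L ηΨ = ∫⁻ X in cellN N L, W X * (‖Ψ X‖₊ : ℝ≥0∞) ^ 2) →
    (∀ (N : ℕ) (L : ℝ), 0 < L → ∀ V : Fin N → Fin N → ℝ → ℝ≥0∞,
      ∃ C : ℝ, 0 ≤ C ∧ ∀ s : ℝ, 0 < s → s ≤ L →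
        ∃ ξ : Config N → ℝ, ContDiff ℝ 1 ξ ∧ IsTorusPeriodic L ξ ∧ (∀ X, 0 ≤ ξ X ∧ ξ X ≤ 1) ∧
          (∀ X ∈ hardLayerP V L (s / 2), ξ X = 0) ∧
          (∀ X ∉ hardLayerP V L s, ∀ X' : Config N, (∀ i, ‖X' i - X i‖ < s / 10) → ξ X' = 1) ∧
          ∀ X, ‖fderiv ℝ ξ X‖ ≤ C / s) →
    ∀ (N : ℕ) (L : ℝ), 0 < L → ∀ V : Fin N → Fin N → ℝ → ℝ≥0∞, (∀ i j, V i j = V j i) →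
      (∀ i j, IsRepulsiveFiniteRange (V i j)) →
      ∀ (ζ : Lp ℂ 2 (volume : Measure (UnitAddTorus (Fin N × Fin 3)))) (k : ℝ),
        (∀ᵐ t ∂(volume : Measure (UnitAddTorus (Fin N × Fin 3))), ‖(ζ : UnitAddTorus (Fin N × Fin 3) → ℂ) t‖ ≤ k) →
        (∀ ε' : ℝ, 0 < ε' → ∃ s₀ : ℝ, 0 < s₀ ∧ ∀ s : ℝ, 0 < s → s ≤ s₀ →
          ∫⁻ t in fromUnitTorusN L ⁻¹' hardLayerP V L s,
            ((‖(ζ : UnitAddTorus (Fin N × Fin 3) → ℂ) t‖₊ : ℝ≥0∞)) ^ 2 ≤ ENNReal.ofReal (ε' * s ^ 2)) →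
        ∀ ε : ℝ, 0 < ε →
          absGroundStateEnergyW (pairInteraction V L) L * ENNReal.ofReal (‖ζ‖ ^ 2 - ε) ≤
            ENNReal.ofReal (1 + ε) * maxFormW (pairInteraction V L) L ζ + ENNReal.ofReal ε := by
  intro hD hK N L hL V _ hV ζ k hbound hlayer ε hε
  classical
  rw [maxFormW_def]
  obtain ⟨K, hKdef⟩ : ∃ K : ℝ≥0∞, K = maxFormKin L ζ := ⟨_, rfl⟩
  obtain ⟨V₀, hV₀def⟩ : ∃ V₀ : ℝ≥0∞, V₀ = maxFormPotW (pairInteraction V L) L ζ := ⟨_, rfl⟩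
  rw [← hKdef, ← hV₀def]
  obtain ⟨C, -, hcut⟩ := hK N L hL V
  obtain ⟨A₁, hA₁⟩ : ∃ A₁ : ℝ, A₁ = (1 + ε⁻¹) * (3 * N) * C ^ 2 := ⟨_, rfl⟩
  have hA₁0 : 0 ≤ A₁ := by rw [hA₁]; positivity
  obtain ⟨ε', hε'⟩ : ∃ ε' : ℝ, ε' = ε / (8 * (A₁ + 1)) := ⟨_, rfl⟩
  have hε'0 : 0 < ε' := by rw [hε']; positivity
  obtain ⟨s₀, hs₀, hs₀layer⟩ := hlayer ε' hε'0
  obtain ⟨s, hsdef⟩ : ∃ s : ℝ, s = min (min s₀ L) 1 := ⟨_, rfl⟩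
  have hs : 0 < s := by rw [hsdef]; exact lt_min (lt_min hs₀ hL) one_pos
  have hss₀ : s ≤ s₀ := by rw [hsdef]; exact (min_le_left _ _).trans (min_le_left _ _)
  have hsL : s ≤ L := by rw [hsdef]; exact (min_le_left _ _).trans (min_le_right _ _)
  have hs1 : s ≤ 1 := by rw [hsdef]; exact min_le_right _ _
  have hJζ := hs₀layer s hs hss₀
  obtain ⟨ξ, hξdiff, hξper, hξ01, hξ0, hξ1, hξD⟩ := hcut s hs hsL
  -- the softened profiles
  set w : Fin N → Fin N → ℝ → ℝ≥0∞ := fun i j => softProfile (V i j) (s / 2)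
  have hw : ∀ i j, Measurable (w i j) := fun i j => measurable_softProfile (hV i j).1 _
  have hwv : ∀ i j r, w i j r ≤ V i j r := fun i j r => softProfile_le (V i j) _ r
  have hWint : ∫⁻ X in cellN N L, pairInteraction w L X ≠ ⊤ :=
    lintegral_cellN_pairInteraction_softProfile_ne_top hL hV (half_pos hs)
  obtain ⟨e, hedef⟩ : ∃ e : ℝ, e = min (ε / 8) (min (ε / (8 * (‖ζ‖ + 1))) (min 1 (s ^ 2 * ε / (8 * (A₁ + 1))))) :=
    ⟨_, rfl⟩
  have he0 : 0 < e := by rw [hedef]; exact lt_min (by positivity) (lt_min (by positivity) (lt_min one_pos (by positivity)))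
  have he8 : e ≤ ε / 8 := by rw [hedef]; exact min_le_left _ _
  have heζ : e ≤ ε / (8 * (‖ζ‖ + 1)) := by rw [hedef]; exact (min_le_right _ _).trans (min_le_left _ _)
  have he1 : e ≤ 1 := by rw [hedef]; exact (min_le_right _ _).trans ((min_le_right _ _).trans (min_le_left _ _))
  have hes : e ≤ s ^ 2 * ε / (8 * (A₁ + 1)) := by
    rw [hedef]; exact (min_le_right _ _).trans ((min_le_right _ _).trans (min_le_right _ _))
  obtain ⟨S, a, hkin, hpot, hdist⟩ :=
    exists_trigPoly_maxFormW_approx hL (measurable_pairInteraction hw L) hWint ζ hbound he0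
  obtain ⟨P, hPdef⟩ : ∃ P : L2T N, P = ∑ m ∈ S, a m • (mFourierLp 2 m : L2T N) := ⟨_, rfl⟩
  rw [← hPdef] at hkin hpot hdist
  -- the polynomial as a plain `C¹` periodic function
  set Ψc : Config N → ℂ := fun X => ((cellScale N L)⁻¹ : ℂ) * ∑ n ∈ S, a n * cellWaveN L n X with hΨcdef
  have hΨ1 : ContDiff ℝ 1 Ψc :=
    contDiff_const.mul (ContDiff.sum fun n _ => contDiff_const.mul (contDiff_cellWaveN L n))
  have hΨper : IsTorusPeriodic L Ψc := by
    intro X i k'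
    simp only [hΨcdef, cellWaveN_periodic hL.ne' _ X i k']
  obtain ⟨P', hΨae, hNP, hKP, hpotP⟩ := hD N L hL Ψc hΨ1 hΨper
  have hsc : cellScale N L ≠ 0 := by
    rw [cellScale]; exact (Real.sqrt_pos.2 (by positivity)).ne'
  have hηP : P' = P := by
    rw [hPdef]
    refine Lp.ext ?_
    filter_upwards [hΨae, HaarTorus.coeFn_sum_smul_mFourierLp S a] with t h1 h2
    rw [h1, h2]
    simp only [hΨcdef, cellWaveN, toUnitTorusN_fromUnitTorusN hL.ne', ← mul_assoc]
    rw [mul_inv_cancel₀ (by exact_mod_cast hsc), one_mul]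
  rw [hηP] at hNP hKP hpotP
  -- the cut-off product
  set Φc : Config N → ℂ := fun X => (ξ X : ℂ) * Ψc X with hΦcdef
  have hΦ1 : ContDiff ℝ 1 Φc := (Complex.ofRealCLM.contDiff.comp hξdiff).mul hΨ1
  have hΦper : IsTorusPeriodic L Φc := by
    intro X i k'
    simp only [hΦcdef, hξper X i k', hΨper X i k']
  obtain ⟨ηΦ, -, hNΦ, -, -⟩ := hD N L hL Φc hΦ1 hΦper
  set A : Set (Config N) := hardLayerP V L s
  have hAm : MeasurableSet A := measurableSet_hardLayerP V L s
  have hfd0 : ∀ X ∉ A, fderiv ℝ ξ X = 0 := by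
    intro X hX
    have hev : ξ =ᶠ[𝓝 X] fun _ => (1 : ℝ) := by
      filter_upwards [Metric.ball_mem_nhds X (show 0 < s / 10 by positivity)] with X' hX'
      refine hξ1 X hX X' fun i => ?_
      rw [← dist_eq_norm]
      exact (dist_pi_lt_iff (by positivity)).1 (mem_ball.1 hX') i
    rw [hev.fderiv_eq, fderiv_const_apply]
  have hξone : ∀ X ∉ A, ξ X = 1 := fun X hX => hξ1 X hX X fun i => by rw [sub_self, norm_zero]; positivity
  have hξd : Differentiable ℝ ξ := hξdiff.differentiable one_ne_zero
  have hΨd : Differentiable ℝ Ψc := hΨ1.differentiable one_ne_zero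
  -- measurability facts
  have hWwm : Measurable (pairInteraction w L) := measurable_pairInteraction hw L
  have hIm : Measurable (A.indicator (1 : Config N → ℝ≥0∞)) := measurable_one.indicator hAm
  have hΨsqm : Measurable fun X : Config N => ((‖Ψc X‖₊ : ℝ≥0∞)) ^ 2 :=
    hΨ1.continuous.measurable.nnnorm.coe_nnreal_ennreal.pow_const _
  have hΦsqm : Measurable fun X : Config N => ((‖Φc X‖₊ : ℝ≥0∞)) ^ 2 :=
    hΦ1.continuous.measurable.nnnorm.coe_nnreal_ennreal.pow_const _
  -- the dictionary between the torus and the cell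
  have hvar : absGroundStateEnergyW (pairInteraction V L) L * ENNReal.ofReal (‖ηΦ‖ ^ 2) ≤
      (∫⁻ X in cellN N L, kineticDensity Φc X) +
        ∫⁻ X in cellN N L, pairInteraction V L X * (‖Φc X‖₊ : ℝ≥0∞) ^ 2 := by
    rw [hNΦ, ← lintegral_add_left (measurable_kineticDensity_any _)]
    exact pairStep_absGroundStateEnergyW_mul_le hΦ1 hΦper
  have hVP : maxFormPotW (pairInteraction w L) L P =
      ∫⁻ X in cellN N L, pairInteraction w L X * (‖Ψc X‖₊ : ℝ≥0∞) ^ 2 := hpotP _ hWwm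
  -- the Config-side estimates
  obtain ⟨cD, hcD⟩ : ∃ cD : ℝ, cD = (1 + ε⁻¹) * (3 * N) * (C / s) ^ 2 := ⟨_, rfl⟩
  have hcD0 : 0 ≤ cD := by rw [hcD]; positivity
  have hI1 : ∫⁻ X in cellN N L, kineticDensity Φc X ≤
      ENNReal.ofReal (1 + ε) * (∫⁻ X in cellN N L, kineticDensity Ψc X) +
        ENNReal.ofReal cD * (∫⁻ X in cellN N L, A.indicator (1 : Config N → ℝ≥0∞) X * (‖Ψc X‖₊ : ℝ≥0∞) ^ 2) := by
    calc ∫⁻ X in cellN N L, kineticDensity Φc X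
        ≤ ∫⁻ X in cellN N L, (ENNReal.ofReal (1 + ε) * kineticDensity Ψc X +
            ENNReal.ofReal cD * A.indicator (1 : Config N → ℝ≥0∞) X * (‖Ψc X‖₊ : ℝ≥0∞) ^ 2) :=
          lintegral_mono fun X => by rw [hcD]; exact kineticDensity_cutoff_mul_le hξd hΨd hξ01 hξD hfd0 hε X
      _ = _ := by
          rw [lintegral_add_left ((measurable_kineticDensity_any _).const_mul _), lintegral_const_mul _
            (measurable_kineticDensity_any _)]
          simp only [mul_assoc]
          rw [lintegral_const_mul _ (show Measurable (fun X : Config N => A.indicator (1 : Config N → ℝ≥0∞) X *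
            ((‖Ψc X‖₊ : ℝ≥0∞) ^ 2)) from hIm.mul hΨsqm)]
  have hI2 : ∫⁻ X in cellN N L, pairInteraction V L X * (‖Φc X‖₊ : ℝ≥0∞) ^ 2 ≤
      ∫⁻ X in cellN N L, pairInteraction w L X * (‖Ψc X‖₊ : ℝ≥0∞) ^ 2 :=
    lintegral_mono fun X => pot_ofReal_mul_le_softProfile hξ01 hξ0 _ X
  have hI3 : ∫⁻ X in cellN N L, (‖Ψc X‖₊ : ℝ≥0∞) ^ 2 ≤
      (∫⁻ X in cellN N L, (‖Φc X‖₊ : ℝ≥0∞) ^ 2) +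
        ∫⁻ X in cellN N L, A.indicator (1 : Config N → ℝ≥0∞) X * (‖Ψc X‖₊ : ℝ≥0∞) ^ 2 := by
    calc ∫⁻ X in cellN N L, (‖Ψc X‖₊ : ℝ≥0∞) ^ 2
        ≤ ∫⁻ X in cellN N L, ((‖Φc X‖₊ : ℝ≥0∞) ^ 2 +
            A.indicator (1 : Config N → ℝ≥0∞) X * (‖Ψc X‖₊ : ℝ≥0∞) ^ 2) :=
          lintegral_mono fun X => nnnorm_sq_le_add_indicator (A := A) hξone _ X
      _ = _ := lintegral_add_left hΦsqm _
  -- the mass of `P` in the layer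
  obtain ⟨J, hJdef⟩ : ∃ J : ℝ≥0∞, J = ∫⁻ t, A.indicator (1 : Config N → ℝ≥0∞) (fromUnitTorusN L t) *
      (‖(P : UnitAddTorus (Fin N × Fin 3) → ℂ) t‖₊ : ℝ≥0∞) ^ 2 := ⟨_, rfl⟩
  have hJP : J = ∫⁻ X in cellN N L, A.indicator (1 : Config N → ℝ≥0∞) X * (‖Ψc X‖₊ : ℝ≥0∞) ^ 2 := by
    rw [hJdef]; exact hpotP _ hIm
  have htwo : ∀ x : ℝ, 0 ≤ x → (2 : ℝ≥0∞) * ENNReal.ofReal x = ENNReal.ofReal (2 * x) := fun x _ => by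
    rw [ENNReal.ofReal_mul (by norm_num), ENNReal.ofReal_ofNat]
  have hJ : J ≤ 2 * ENNReal.ofReal (ε' * s ^ 2) + 2 * ENNReal.ofReal (e ^ 2) := by
    have hsub : ∀ᵐ t ∂(volume : Measure (UnitAddTorus (Fin N × Fin 3))),
        ((P - ζ : L2T N) : UnitAddTorus (Fin N × Fin 3) → ℂ) t =
          (P : UnitAddTorus (Fin N × Fin 3) → ℂ) t - (ζ : UnitAddTorus (Fin N × Fin 3) → ℂ) t := Lp.coeFn_sub P ζ
    have h1 : J ≤ ∫⁻ t, (2 * (A.indicator (1 : Config N → ℝ≥0∞) (fromUnitTorusN L t) *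
        (‖(ζ : UnitAddTorus (Fin N × Fin 3) → ℂ) t‖₊ : ℝ≥0∞) ^ 2) +
          2 * (‖((P - ζ : L2T N) : UnitAddTorus (Fin N × Fin 3) → ℂ) t‖₊ : ℝ≥0∞) ^ 2) := by
      rw [hJdef]
      refine lintegral_mono_ae (hsub.mono fun t ht => ?_)
      rw [ht]
      have hsq : ((‖(P : UnitAddTorus (Fin N × Fin 3) → ℂ) t‖₊ : ℝ≥0∞)) ^ 2 ≤
          2 * (‖(ζ : UnitAddTorus (Fin N × Fin 3) → ℂ) t‖₊ : ℝ≥0∞) ^ 2 +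
            2 * (‖(P : UnitAddTorus (Fin N × Fin 3) → ℂ) t - (ζ : UnitAddTorus (Fin N × Fin 3) → ℂ) t‖₊ : ℝ≥0∞) ^ 2 := by
        rw [coe_nnnorm_sq_eq_ofReal, coe_nnnorm_sq_eq_ofReal, coe_nnnorm_sq_eq_ofReal, htwo _ (sq_nonneg _),
          htwo _ (sq_nonneg _), ← ENNReal.ofReal_add (by positivity) (by positivity)]
        refine ENNReal.ofReal_le_ofReal ?_
        have h := norm_add_le ((ζ : UnitAddTorus (Fin N × Fin 3) → ℂ) t)
          ((P : UnitAddTorus (Fin N × Fin 3) → ℂ) t - (ζ : UnitAddTorus (Fin N × Fin 3) → ℂ) t)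
        rw [add_sub_cancel] at h
        have h' := pow_le_pow_left₀ (norm_nonneg _) h 2
        nlinarith [h', sq_nonneg (‖(ζ : UnitAddTorus (Fin N × Fin 3) → ℂ) t‖ -
          ‖(P : UnitAddTorus (Fin N × Fin 3) → ℂ) t - (ζ : UnitAddTorus (Fin N × Fin 3) → ℂ) t‖)]
      by_cases hA' : fromUnitTorusN L t ∈ A
      · rw [indicator_of_mem hA', Pi.one_apply, one_mul, one_mul]; exact hsq
      · rw [indicator_of_notMem hA']
        simp
    have hζm : AEMeasurable (fun t => 2 * (A.indicator (1 : Config N → ℝ≥0∞) (fromUnitTorusN L t) *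
        (‖(ζ : UnitAddTorus (Fin N × Fin 3) → ℂ) t‖₊ : ℝ≥0∞) ^ 2)) volume :=
      (((measurable_one.indicator hAm).comp (measurable_fromUnitTorusN L)).mul
        ((Lp.stronglyMeasurable ζ).measurable.nnnorm.coe_nnreal_ennreal.pow_const 2)).aemeasurable.const_mul _
    refine h1.trans ?_
    rw [lintegral_add_left' hζm, lintegral_const_mul' _ _ (by norm_num), lintegral_const_mul' _ _ (by norm_num),
      lintegral_indicator_preimage_mul' hAm]
    refine add_le_add (mul_le_mul_right hJζ _) (mul_le_mul_right ?_ _)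
    rw [← ENNReal.ofReal_toReal (norm_Lp_two_sq_eq_toReal (P - ζ)).2, ← (norm_Lp_two_sq_eq_toReal (P - ζ)).1]
    exact ENNReal.ofReal_le_ofReal (pow_le_pow_left₀ (norm_nonneg _) hdist 2)
  have hJtop : J ≠ ⊤ := ne_top_of_le_ne_top (by
    exact ENNReal.add_ne_top.2 ⟨ENNReal.mul_ne_top (by norm_num) ENNReal.ofReal_ne_top,
      ENNReal.mul_ne_top (by norm_num) ENNReal.ofReal_ne_top⟩) hJ
  -- the error budget in the reals
  have herr_real : cD * (2 * (ε' * s ^ 2) + 2 * e ^ 2) + e ≤ ε := by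
    have h1 : cD * (ε' * s ^ 2) = A₁ * ε' := by rw [hcD, hA₁]; field_simp
    have hA₁1 : 0 < A₁ + 1 := by linarith only [hA₁0]
    have h2 : A₁ * ε' ≤ ε / 8 := by
      rw [hε', mul_div_assoc', div_le_div_iff₀ (by linarith only [hA₁1]) (by norm_num)]
      nlinarith only [hA₁0, hε]
    have h3 : cD * e ^ 2 ≤ ε / 8 := by
      have h4 : e ^ 2 ≤ e * (s ^ 2 * ε / (8 * (A₁ + 1))) := by
        rw [sq]; exact mul_le_mul_of_nonneg_left hes he0.le
      have h5 : cD * (s ^ 2 * ε / (8 * (A₁ + 1))) = A₁ * ε / (8 * (A₁ + 1)) := by rw [hcD, hA₁]; field_simp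
      have h6 : A₁ * ε / (8 * (A₁ + 1)) ≤ ε / 8 := by
        rw [div_le_div_iff₀ (by linarith only [hA₁1]) (by norm_num)]; nlinarith only [hA₁0, hε]
      calc cD * e ^ 2 ≤ cD * (e * (s ^ 2 * ε / (8 * (A₁ + 1)))) := mul_le_mul_of_nonneg_left h4 hcD0
        _ = e * (cD * (s ^ 2 * ε / (8 * (A₁ + 1)))) := by ring
        _ ≤ 1 * (ε / 8) := by rw [h5]; exact mul_le_mul he1 h6 (by positivity) zero_le_one
        _ = ε / 8 := one_mul _
    have h7 : cD * (2 * (ε' * s ^ 2) + 2 * e ^ 2) = 2 * (cD * (ε' * s ^ 2)) + 2 * (cD * e ^ 2) := by ring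
    rw [h7, h1]
    linarith only [h2, h3, he8, hε]
  have herr : ENNReal.ofReal cD * (2 * ENNReal.ofReal (ε' * s ^ 2) + 2 * ENNReal.ofReal (e ^ 2)) + ENNReal.ofReal e ≤
      ENNReal.ofReal ε := by
    rw [htwo _ (by positivity), htwo _ (by positivity), ← ENNReal.ofReal_add (by positivity) (by positivity),
      ← ENNReal.ofReal_mul hcD0, ← ENNReal.ofReal_add (by positivity) he0.le]
    exact ENNReal.ofReal_le_ofReal herr_real
  -- the main chain
  have hpotζ : maxFormPotW (pairInteraction w L) L ζ ≤ V₀ := by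
    rw [hV₀def]
    exact lintegral_mono fun t => mul_le_mul_left (pairInteraction_mono_profile hwv L _) _
  have hmain : absGroundStateEnergyW (pairInteraction V L) L * ENNReal.ofReal (‖ηΦ‖ ^ 2) ≤
      ENNReal.ofReal (1 + ε) * (K + V₀) + ENNReal.ofReal ε := by
    calc _ ≤ _ := hvar
      _ ≤ (ENNReal.ofReal (1 + ε) * (∫⁻ X in cellN N L, kineticDensity Ψc X) +
            ENNReal.ofReal cD * (∫⁻ X in cellN N L, A.indicator (1 : Config N → ℝ≥0∞) X * (‖Ψc X‖₊ : ℝ≥0∞) ^ 2)) +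
          ∫⁻ X in cellN N L, pairInteraction w L X * (‖Ψc X‖₊ : ℝ≥0∞) ^ 2 := add_le_add hI1 hI2
      _ = ENNReal.ofReal (1 + ε) * maxFormKin L P + ENNReal.ofReal cD * J + maxFormPotW (pairInteraction w L) L P := by
          rw [hKP, hJP, hVP]
      _ ≤ ENNReal.ofReal (1 + ε) * K + ENNReal.ofReal cD * (2 * ENNReal.ofReal (ε' * s ^ 2) + 2 * ENNReal.ofReal (e ^ 2)) +
          (V₀ + ENNReal.ofReal e) := by
          gcongr
          · rw [hKdef]; exact hkin
          · exact hpot.trans (add_le_add hpotζ le_rfl)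
      _ = ENNReal.ofReal (1 + ε) * K + V₀ +
          (ENNReal.ofReal cD * (2 * ENNReal.ofReal (ε' * s ^ 2) + 2 * ENNReal.ofReal (e ^ 2)) + ENNReal.ofReal e) := by
          ring
      _ ≤ ENNReal.ofReal (1 + ε) * K + ENNReal.ofReal (1 + ε) * V₀ + ENNReal.ofReal ε := by
          refine add_le_add (add_le_add le_rfl ?_) herr
          calc V₀ = 1 * V₀ := (one_mul V₀).symm
            _ ≤ ENNReal.ofReal (1 + ε) * V₀ := by
                gcongr; rw [← ENNReal.ofReal_one]; exact ENNReal.ofReal_le_ofReal (by linarith)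
      _ = ENNReal.ofReal (1 + ε) * (K + V₀) + ENNReal.ofReal ε := by ring
  -- the norm from below
  have hnorm : ENNReal.ofReal (‖ζ‖ ^ 2 - ε) ≤ ENNReal.ofReal (‖ηΦ‖ ^ 2) := by
    refine ENNReal.ofReal_le_ofReal ?_
    have h1 : ENNReal.ofReal (‖P‖ ^ 2) ≤ ENNReal.ofReal (‖ηΦ‖ ^ 2) + J := by rw [hNP, hNΦ, hJP]; exact hI3
    have h2 : ‖P‖ ^ 2 ≤ ‖ηΦ‖ ^ 2 + J.toReal := by
      have := ENNReal.toReal_mono (ENNReal.add_ne_top.2 ⟨ENNReal.ofReal_ne_top, hJtop⟩) h1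
      rwa [ENNReal.toReal_ofReal (sq_nonneg _), ENNReal.toReal_add ENNReal.ofReal_ne_top hJtop,
        ENNReal.toReal_ofReal (sq_nonneg _)] at this
    have h3 : J.toReal ≤ 2 * (ε' * s ^ 2) + 2 * e ^ 2 := by
      have := ENNReal.toReal_mono (ENNReal.add_ne_top.2 ⟨ENNReal.mul_ne_top (by norm_num) ENNReal.ofReal_ne_top,
        ENNReal.mul_ne_top (by norm_num) ENNReal.ofReal_ne_top⟩) hJ
      rwa [ENNReal.toReal_add (ENNReal.mul_ne_top (by norm_num) ENNReal.ofReal_ne_top)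
        (ENNReal.mul_ne_top (by norm_num) ENNReal.ofReal_ne_top), ENNReal.toReal_mul, ENNReal.toReal_mul,
        ENNReal.toReal_ofReal (by positivity), ENNReal.toReal_ofReal (by positivity), ENNReal.toReal_ofNat] at this
    have h4 : ‖ζ‖ - e ≤ ‖P‖ := by
      have := (abs_le.1 (abs_norm_sub_norm_le P ζ)).1
      linarith only [this, hdist]
    have hee : e ^ 2 ≤ e := by rw [sq]; exact mul_le_of_le_one_left he0.le he1
    have hA₁1 : 0 < A₁ + 1 := by linarith only [hA₁0]
    have h5 : 2 * (ε' * s ^ 2) ≤ ε / 4 := by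
      have hs2 : s ^ 2 ≤ 1 := pow_le_one₀ hs.le hs1
      have hε'le : ε' ≤ ε / 8 := by
        rw [hε', div_le_div_iff₀ (by linarith only [hA₁1]) (by norm_num)]
        nlinarith only [hA₁0, hε]
      have := mul_le_mul_of_nonneg_left hs2 hε'0.le
      linarith only [this, hε'le]
    have h6 : 2 * e ^ 2 ≤ ε / 4 := by linarith only [hee, he8]
    have h7 : 2 * e * ‖ζ‖ ≤ ε / 4 := by
      have hz1 : (0 : ℝ) < 8 * (‖ζ‖ + 1) := by linarith only [norm_nonneg ζ]
      have := (le_div_iff₀ hz1).1 heζ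
      have h8e : 0 ≤ e := he0.le
      nlinarith only [norm_nonneg ζ, h8e, this]
    rcases le_or_gt ‖ζ‖ e with hζe | hζe
    · have : ‖ζ‖ ^ 2 ≤ e ^ 2 := pow_le_pow_left₀ (norm_nonneg _) hζe 2
      linarith only [this, hee, he8, sq_nonneg ‖ηΦ‖, hε]
    · have h8 : (‖ζ‖ - e) ^ 2 ≤ ‖P‖ ^ 2 := pow_le_pow_left₀ (by linarith only [hζe]) h4 2
      have h9 : (‖ζ‖ - e) ^ 2 = ‖ζ‖ ^ 2 - 2 * e * ‖ζ‖ + e ^ 2 := by ring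
      linarith only [h8, h2, h3, h5, h6, h7, h9, sq_nonneg e]
  -- conclusion
  calc absGroundStateEnergyW (pairInteraction V L) L * ENNReal.ofReal (‖ζ‖ ^ 2 - ε)
      ≤ absGroundStateEnergyW (pairInteraction V L) L * ENNReal.ofReal (‖ηΦ‖ ^ 2) := mul_le_mul_right hnorm _
    _ ≤ _ := hmain

end Summit.AtomisticToContinuum.BoseEinsteinCondensation.Cruxes.TorusHalfSwapOverlap.TruncationSplit

end
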